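import Summits.CriticalPhenomena.PercolationContinuityZ3.Theorems.Transplant.GrigorchukLamplighterCylinderLines
import Summits.CriticalPhenomena.PercolationContinuityZ3.Theorems.Transplant.SubgraphLocModCycleA
import HarnessLib

/-!
# Cylinder kits on Bartholdi–Erschler's graph, II: KIT 1 (a `b/c/d`-rung) and KIT 2 (an edge of a lamp line) as `SubLoc.CycleKit`s of
# the pair (`Cay[‖bs‖_∞ ≤ ℓ+1]`, edges inside `‖bs‖_∞ ≤ ℓ`)

builds on p205010 (kernel theorem, internal audit signed; external expert review pending) — nothing in this file uses p205010.  Lane `prim-bschramm`, seat `prim-bschramm-p3` gen 38 (DESIGN OWNER; offer O17 = O3-direct,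
`P3-NILPOTENT.md` §31).  Helper file (`--supports stmt-CriticalPhenomena-4575 --as helper`).  Sequel of «GrigorchukLamplighterCylinderLines».  Nothing is claimed
here about `θ(p_c)`.

A `SubLoc.CycleKit H E' x y` («SubgraphLocModCycle» p4 g10) is a cycle `x —A→ p —M→ q —B→ y —e→ x` through the subgraph edge `e = {x, y}` whose run `M` consists
of ENHANCEMENT edges, with `A`, `M`, `B` paths meeting only at the junctions; «SubgraphLocModCycleA» `exists_routeData_of_pivotal` turns it into the local
modification of the Aizenman–Grimmett / Menshikov argument.  Here `H = cylH (ℓ+1)`, `E' = Eenh ℓ`, and for an edge of `Cay` with both ends in box `ℓ`: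
* §3 **KIT 1** (`kit1`), `e = {x, x t}`, `t ∈ {b, c, d}`: `A` = the column of `x` (`x sʲ`, `j ≤ K`), `M` = the single `t`-rung `{x s^K, x t s^K}` at the ceiling
  (`t` commutes with `s`), `B` = the column of `x t` downwards; disjointness by the tree parts `g ≠ g t` (`right_ne_of_rung`).
* §4 **KIT 2** (`kit2`), `e = {y s, y}` (`x = y s`): `A` = the column of `x`, `M` = the `b`-rung `{x s^K, y b s^{K+1}}` at the ceiling, `B` = the parallel
  line `y b sʲ` downwards followed by the edge `y b — y` (`walkB2`); disjointness by tree parts (`right_ne_of_line`) and by `s`-power injectivity.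
Lengths: `kit1_lengths`, `kit2_lengths` (`|A| = K x`, `|M| = 1`, `|B| = K x` resp. `K x + 2`).  The corner kit (`a`-edges) and the zone radius are the sequel
«GrigorchukLamplighterCylinderCorner».
[cite: BalisterBollobasRiordan2014, §"bond percolation" p. 13] [cite: AizenmanGrimmett1991, Thm 1 (essential enhancements)] [cite: BartholdiErschler2012, §2, §3.1]
-/

noncomputable section

namespace Summit.CriticalPhenomena.PercolationContinuityZ3.Theorems.Transplant

namespace Grigorchuk

open SimpleGraph Walk SemidirectProduct Literature.Probability.LatticeModels SubLoc CayCyl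
open Literature.Barriers.CriticalPhenomena (graphBall graphBall_mono)
open scoped Classical

section Kit

variable {ℓ : ℕ} (x y : ↥(blockCyl (box 2 (ℓ + 1))))

/-! ## §3 Kit 1: the edge `{x, x·t}`, `t ∈ {b, c, d}` (a rung of a ladder) -/

section Kit1

variable {x y} {t : L6} (hc : t.isTree = true) (hxy : y.1 = x.1 * t.toW) (hx : bs x.1 ∈ box 2 ℓ)
include hc hxy

/-- Along a rung the block sums and the block index agree. [folklore] -/
theorem bs_eq_of_rung : bs y.1 = bs x.1 ∧ idx y.1 = idx x.1 ∧ K y = K x := by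
  have h1 : bs y.1 = bs x.1 := by rw [hxy, bs_mul_tree x.1 (toW_left_of_isTree hc)]
  have h2 : idx y.1 = idx x.1 := by rw [hxy, idx_mul_of_fix x.1 (toW_rho_of_isTree hc)]
  exact ⟨h1, h2, by unfold K; rw [h1, h2]⟩

/-- The tops of the two columns are joined by the `t`-rung at the ceiling: `p t = q`. [folklore] -/
theorem pt_mul_of_rung : pt x * t.toW = pt y := by
  rw [pt, pt, (bs_eq_of_rung hc hxy).2.2, hxy, mul_assoc, sW_pow_mul_toW_of_isTree hc, mul_assoc]

/-- Tree parts differ across the rung. [folklore] -/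
theorem right_ne_of_rung (i j : ℕ) : (((x.1 * sW ^ i : ↥wreathZ)) : LampGroup ℤ).right ≠ (((y.1 * sW ^ j : ↥wreathZ)) : LampGroup ℤ).right := by
  rw [right_mul_sW_pow, right_mul_sW_pow, hxy, right_mul]
  intro h
  exact right_toW_ne_one hc (mul_left_cancel (a := ((x.1 : LampGroup ℤ)).right) (by rw [mul_one]; exact h.symm))

include hx in
/-- **KIT 1** (rung edge `{x, x t}`, `t ∈ {b,c,d}`): column of `x` up, the `t`-rung at the ceiling, column of `x t` down.
[cite: BalisterBollobasRiordan2014, §"bond percolation" p. 13] -/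
def kit1 : CycleKit (cylH (ℓ + 1)) (Eenh ℓ) x y where
  p := pV x
  q := pV y
  A := colA x
  M := Walk.cons (induce_adj.2 (show CayS.Adj (pt x) (pt y) by rw [← pt_mul_of_rung hc hxy]; exact cay_adj_mul _ t)) Walk.nil
  B := (colA y).reverse
  hA := (colA_isPath x).1
  hM := by
    rw [cons_isPath_iff]
    refine ⟨IsPath.nil, fun h => ?_⟩
    rw [support_nil, List.mem_singleton] at h
    exact ne_of_right_ne (right_ne_of_rung hc hxy (K x) (K y)) (congrArg Subtype.val h)
  hB := (colA_isPath y).1.reverse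
  hpq := fun h => ne_of_right_ne (right_ne_of_rung hc hxy (K x) (K y)) (congrArg Subtype.val h)
  hxp := fun h => by
    have e : bs x.1 (idx x.1) = bs (pt x) (idx x.1) := by rw [show pt x = x.1 from (congrArg Subtype.val h).symm]
    rw [bs_pt_idx] at e
    have := (mem_box.1 hx) (idx x.1); omega
  hqy := fun h => by
    have hy : bs y.1 ∈ box 2 ℓ := by rw [(bs_eq_of_rung hc hxy).1]; exact hx
    have e : bs y.1 (idx y.1) = bs (pt y) (idx y.1) := by rw [show pt y = y.1 from congrArg Subtype.val h]
    rw [bs_pt_idx] at e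
    have := (mem_box.1 hy) (idx y.1); omega
  hAM := fun w hwA hwM => by
    rw [support_cons, support_nil, List.mem_cons, List.mem_singleton] at hwM
    rcases hwM with h | h
    · exact h
    · obtain ⟨i, -, hi⟩ := mem_colA x hwA
      exact absurd ((congrArg Subtype.val h).symm.trans hi) (ne_of_right_ne (right_ne_of_rung hc hxy i (K y)).symm)
  hMB := fun w hwM hwB => by
    rw [support_cons, support_nil, List.mem_cons, List.mem_singleton] at hwM
    rcases hwM with h | h
    · obtain ⟨j, -, hj⟩ := mem_colA y ((mem_support_reverse_iff _ w).1 hwB)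
      exact absurd ((congrArg Subtype.val h).symm.trans hj) (ne_of_right_ne (right_ne_of_rung hc hxy (K x) j))
    · exact h
  hAB := fun w hwA hwB => by
    obtain ⟨i, -, hi⟩ := mem_colA x hwA
    obtain ⟨j, -, hj⟩ := mem_colA y ((mem_support_reverse_iff _ w).1 hwB)
    exact ne_of_right_ne (right_ne_of_rung hc hxy i j) (hi.symm.trans hj)
  hME := fun d hd => by
    rw [edges_cons, edges_nil, List.mem_singleton] at hd
    subst hd
    exact ⟨(cylH (ℓ + 1)).mem_edgeSet.2 (induce_adj.2 (show CayS.Adj (pt x) (pt y) by rw [← pt_mul_of_rung hc hxy]; exact cay_adj_mul _ t)),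
      fun hall => bs_pt_not_mem x (hall (pV x) (Sym2.mem_mk_left _ _))⟩
  hyx := induce_adj.2 (show CayS.Adj y.1 x.1 by
    have h : CayS.Adj x.1 (x.1 * t.toW) := cay_adj_mul _ t
    rw [← hxy] at h; exact h.symm)

/-- Kit 1 has columns of length `K` and a one-edge run. [folklore] -/
theorem kit1_lengths : (kit1 hc hxy hx).A.length = K x ∧ (kit1 hc hxy hx).M.length = 1 ∧ (kit1 hc hxy hx).B.length = K x := by
  refine ⟨(colA_isPath x).2, rfl, ?_⟩
  change (colA y).reverse.length = K x
  rw [length_reverse, (colA_isPath y).2, (bs_eq_of_rung hc hxy).2.2]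

end Kit1

/-! ## §4 Kit 2: the edge `{y s, y}` on a lamp line (detour through the parallel line `y b sʲ`) -/

section Kit2

variable {x y} (hxy : x.1 = y.1 * sW) (hx : bs x.1 ∈ box 2 ℓ)

include hxy in
/-- Along the line: `bs x = bs y + e_{idx y}`, same block index, same tree part. [folklore] -/
theorem bs_eq_of_line : bs x.1 = bs y.1 + Pi.single (idx y.1) 1 ∧ idx x.1 = idx y.1 ∧
    ((x.1 : LampGroup ℤ)).right = ((y.1 : LampGroup ℤ)).right := by
  rw [hxy]; exact ⟨bs_mul_sW y.1, idx_mul_sW y.1, right_mul_sW y.1⟩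

/-- The far top `q = y b s^{K+1}`. [folklore] -/
abbrev qt2 (x y : ↥(blockCyl (box 2 (ℓ + 1)))) : ↥wreathZ := y.1 * bW * sW ^ (K x + 1)

include hxy in
/-- `p b = q`: the `b`-rung at the ceiling. [folklore] -/
theorem pt_mul_bW : pt x * bW = qt2 x y := by
  rw [pt, qt2, hxy, mul_assoc y.1 sW, ← pow_succ', mul_assoc, sW_pow_mul_bW, ← mul_assoc]

/-- The detour `y → y b → y b s → … → y b s^{K+1} = q` in `Cay`. [folklore] -/
def walkB2 (x y : ↥(blockCyl (box 2 (ℓ + 1)))) : CayS.Walk y.1 (qt2 x y) :=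
  Walk.cons (cay_adj_bW y.1) (powWalk stdGens cay_adj_sW (y.1 * bW) (K x + 1))

include hxy in
/-- The detour stays in the big cylinder. [folklore] -/
theorem walkB2_mem : ∀ z ∈ (walkB2 x y).support, z ∈ blockCyl (box 2 (ℓ + 1)) := by
  intro z hz
  rw [walkB2, support_cons, List.mem_cons] at hz
  rcases hz with rfl | hz
  · exact y.2
  · have hb : bs (y.1 * bW) = bs y.1 ∧ idx (y.1 * bW) = idx y.1 := ⟨bs_mul_tree y.1 (t := bW) rfl, idx_mul_of_fix y.1 (t := bW) genB_rho⟩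
    have hyC : y.1 * bW ∈ blockCyl (box 2 (ℓ + 1)) := by rw [mem_blockCyl_bs, hb.1]; exact y.2
    refine line_mem hyC ?_ z hz
    rw [hb.1, hb.2]
    have e := K_eq x
    have h1 := (bs_eq_of_line hxy).1
    have h2 := (bs_eq_of_line hxy).2.1
    rw [h1, h2, Pi.add_apply, Pi.single_eq_same] at e
    push_cast; omega

/-- Vertices of the detour: `y` or `y b sʲ`, `j ≤ K + 1`. [folklore] -/
theorem mem_walkB2 {z : ↥wreathZ} (hz : z ∈ (walkB2 x y).support) : z = y.1 ∨ ∃ j, j ≤ K x + 1 ∧ z = y.1 * bW * sW ^ j := by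
  rw [walkB2, support_cons, List.mem_cons] at hz
  rcases hz with h | hz
  · exact Or.inl h
  · exact Or.inr ((mem_support_powWalk _).1 hz)

/-- Tree parts on the parallel line differ from those on the line of `y`. [folklore] -/
theorem right_ne_of_line (i j : ℕ) : (((y.1 * sW ^ i : ↥wreathZ)) : LampGroup ℤ).right ≠ (((y.1 * bW * sW ^ j : ↥wreathZ)) : LampGroup ℤ).right := by
  rw [right_mul_sW_pow, right_mul_sW_pow, right_mul]
  intro h
  exact right_toW_ne_one (t := .b) rfl (mul_left_cancel (a := ((y.1 : LampGroup ℤ)).right) (by rw [mul_one]; exact h.symm))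

/-- The detour is a path. [folklore] -/
theorem walkB2_isPath : (walkB2 x y).IsPath := by
  rw [walkB2, cons_isPath_iff]
  refine ⟨isPath_powWalk _ sW_pow_injective _ _, fun h => ?_⟩
  obtain ⟨j, -, hj⟩ := (mem_support_powWalk _).1 h
  have := right_ne_of_line (y := y) 0 j
  rw [pow_zero, mul_one] at this
  exact this (by rw [← hj])

include hxy hx in
/-- **KIT 2** (line edge `{y s, y}`): column of `x = y s` up to the ceiling, the `b`-rung there, the parallel line down to `y b`, the edge `y b — y`.
[cite: BalisterBollobasRiordan2014, §"bond percolation" p. 13] -/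
def kit2 : CycleKit (cylH (ℓ + 1)) (Eenh ℓ) x y where
  p := pV x
  q := ⟨qt2 x y, walkB2_mem hxy _ (Walk.end_mem_support _)⟩
  A := colA x
  M := Walk.cons (induce_adj.2 (show CayS.Adj (pt x) (qt2 x y) by rw [← pt_mul_bW hxy]; exact cay_adj_bW _)) Walk.nil
  B := ((walkB2 x y).induce (blockCyl (box 2 (ℓ + 1))) (walkB2_mem hxy)).reverse
  hA := (colA_isPath x).1
  hM := by
    rw [cons_isPath_iff]
    refine ⟨IsPath.nil, fun h => ?_⟩
    rw [support_nil, List.mem_singleton] at h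
    have e : pt x = qt2 x y := congrArg Subtype.val h
    rw [pt, hxy, mul_assoc, ← pow_succ', qt2] at e
    exact ne_of_right_ne (right_ne_of_line (y := y) _ _) e
  hB := ((isPath_induce_iff _ _).2 (walkB2_isPath (x := x) (y := y))).reverse
  hpq := fun h => by
    have e : pt x = qt2 x y := congrArg Subtype.val h
    rw [pt, hxy, mul_assoc, ← pow_succ', qt2] at e
    exact ne_of_right_ne (right_ne_of_line (y := y) _ _) e
  hxp := fun h => by
    have e : bs x.1 (idx x.1) = bs (pt x) (idx x.1) := by rw [show pt x = x.1 from (congrArg Subtype.val h).symm]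
    rw [bs_pt_idx] at e
    have := (mem_box.1 hx) (idx x.1); omega
  hqy := fun h => by
    have e : qt2 x y = y.1 := congrArg Subtype.val h
    have := right_ne_of_line (y := y) 0 (K x + 1)
    rw [pow_zero, mul_one] at this
    exact this (by rw [← qt2, e])
  hAM := fun w hwA hwM => by
    rw [support_cons, support_nil, List.mem_cons, List.mem_singleton] at hwM
    rcases hwM with h | h
    · exact h
    · obtain ⟨i, -, hi⟩ := mem_colA x hwA
      have e : qt2 x y = x.1 * sW ^ i := (congrArg Subtype.val h).symm.trans hi
      rw [qt2, hxy, mul_assoc y.1 sW, ← pow_succ'] at e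
      exact absurd e.symm (ne_of_right_ne (right_ne_of_line (y := y) _ _))
  hMB := fun w hwM hwB => by
    rw [support_cons, support_nil, List.mem_cons, List.mem_singleton] at hwM
    rcases hwM with h | h
    · have hw : w.1 ∈ (walkB2 x y).support := (mem_support_induce_iff _ _ w).1 ((mem_support_reverse_iff _ w).1 hwB)
      have e : w.1 = y.1 * sW ^ (K x + 1) := by rw [congrArg Subtype.val h, pow_succ', ← mul_assoc, ← hxy]; rfl
      rcases mem_walkB2 hw with h0 | ⟨j, -, hj⟩
      · have h1 := sW_pow_injective (K x + 1) 0
          (mul_left_cancel (a := y.1) (by rw [pow_zero, mul_one, ← e, h0]))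
        omega
      · exact absurd (e.symm.trans hj) (ne_of_right_ne (right_ne_of_line (y := y) _ _))
    · exact h
  hAB := fun w hwA hwB => by
    obtain ⟨i, -, hi⟩ := mem_colA x hwA
    have hw : w.1 ∈ (walkB2 x y).support := (mem_support_induce_iff _ _ w).1 ((mem_support_reverse_iff _ w).1 hwB)
    rw [hxy, mul_assoc, ← pow_succ'] at hi
    rcases mem_walkB2 hw with h0 | ⟨j, -, hj⟩
    · have h1 := sW_pow_injective (i + 1) 0 (mul_left_cancel (a := y.1) (by rw [pow_zero, mul_one, ← hi, h0]))
      omega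
    · exact ne_of_right_ne (right_ne_of_line (y := y) _ _) (hi.symm.trans hj)
  hME := fun d hd => by
    rw [edges_cons, edges_nil, List.mem_singleton] at hd
    subst hd
    exact ⟨(cylH (ℓ + 1)).mem_edgeSet.2 (induce_adj.2 (show CayS.Adj (pt x) (qt2 x y) by rw [← pt_mul_bW hxy]; exact cay_adj_bW _)),
      fun hall => bs_pt_not_mem x (hall (pV x) (Sym2.mem_mk_left _ _))⟩
  hyx := induce_adj.2 (show CayS.Adj y.1 x.1 by rw [hxy]; exact cay_adj_sW y.1)

include hxy hx in
/-- Kit 2 has columns of length `K`, `K + 2` and a one-edge run. [folklore] -/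
theorem kit2_lengths : (kit2 hxy hx).A.length = K x ∧ (kit2 hxy hx).M.length = 1 ∧ (kit2 hxy hx).B.length = K x + 2 := by
  refine ⟨(colA_isPath x).2, rfl, ?_⟩
  change ((walkB2 x y).induce (blockCyl (box 2 (ℓ + 1))) (walkB2_mem hxy)).reverse.length = K x + 2
  rw [length_reverse, length_induce, walkB2, length_cons, length_powWalk]

end Kit2

end Kit

end Grigorchuk

end Summit.CriticalPhenomena.PercolationContinuityZ3.Theorems.Transplant

end
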